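import Summits.Ventures.PercRepro.S2NullityDescent
import Mathlib.Data.Set.Card.Arithmetic

/-!
# PercRepro — S2: THE TOOLS OF THE NESTED DICHOTOMY (p7, gen 10; sub-claim S2; the `p = 16` row)

A level-`5` cell `(p, d)` is a nested dichotomy on «a set `W` of nullity `k` on `≤ w_k` points», `k = d − 1, …, 4`: in the case
`k` (such a `W` exists, none with nullity `k + 1` on `≤ w_{k+1} ≥ 5 + (k + 1)` points) every rank-`≤ r` set has `≤ r + k` points
(**`S2.ncard_le_of_eRk_le_of_not_nullity`**: a larger one has nullity `≥ k + 1` and the nullity descent inside it produces a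
`W'` of nullity `k + 1` on `≤ r + k + 1 ≤ 5 + (k + 1)` points), so the kit's partition count runs with `f = 5 + k`, `f' = 4 + k`
(**`ThmN.topCount_le_payment_flat`**: the `5`-element top sets paid by `V`, the larger ones by `σ_m(f)·Σ_k s_k·C(n − k, 6 − k)
+ (σ_g(f) − σ_m(f))·C(min f (5 + d), 6)`; **`ThmN.topCount_le_flat`**: the same with the independent `5`-sets `≤ C(n, 5) + C(s3b, 2)`
for the spread case); alternatively the whole top count is paid size by size (**`S2.topCount_le_sum_spanning`**:
`#U(p, q) ≤ Σ_{m=q}^{d} #{B : |B| = m, ρ(E ∖ B) = ρ(E)}`, each term by `S2.ncard_spanning_compl_le_of_nullity`). Axioms: standard.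
-/

open scoped Matroid

namespace PercRepro

namespace S2

open Set

variable {α : Type}

/-- **The top count, size by size**: `#U(p, q) ≤ Σ_{m=q}^{d} #{B ⊆ E : |B| = m, ρ(E ∖ B) = ρ(E)}`. -/
theorem topCount_le_sum_spanning (M : Matroid α) [M.Finite] {p d : ℕ} (hR : M.eRank = (p : ℕ∞))
    (hd : M.E.encard = M.eRank + d) (q : ℕ) :
    Matroid.topCount M p q ≤
      ∑ m ∈ Finset.Icc q d, {B : Set α | B ⊆ M.E ∧ B.ncard = m ∧ M.eRk (M.E \ B) = M.eRank}.ncard := by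
  classical
  refine (topCount_le_ncard_compl_spanning (M := M) hR hd q).trans ?_
  refine le_trans (ncard_le_ncard ?_ ?_) (Finset.set_ncard_biUnion_le (Finset.Icc q d)
    (fun m => {B : Set α | B ⊆ M.E ∧ B.ncard = m ∧ M.eRk (M.E \ B) = M.eRank}))
  · intro B hB
    obtain ⟨hBE, hBr, hBd, hBs⟩ := hB
    have hBfin : B.Finite := M.ground_finite.subset hBE
    have hq : q ≤ B.ncard := by
      have h := M.eRk_le_encard B
      rw [hBr, ← hBfin.cast_ncard_eq] at h
      exact_mod_cast h
    exact Set.mem_iUnion₂.2 ⟨B.ncard, Finset.mem_Icc.2 ⟨hq, hBd⟩, hBE, rfl, hBs⟩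
  · exact M.ground_finite.finite_subsets.subset (fun B hB => by
      obtain ⟨m, -, hB⟩ := Set.mem_iUnion₂.1 hB
      exact hB.1)

/-- **The flat bound below a missing nullity**: if no `W ⊆ E` with `|W| ≤ w` has nullity `k` (`w ≥ 5 + k`), then every set of
rank `≤ r ≤ 5` has fewer than `r + k` points (a set with `≥ r + k` points has nullity `≥ k`; descent to nullity `k` inside it). -/
theorem ncard_le_of_eRk_le_of_not_nullity (M : Matroid α) [M.Finite] (k w : ℕ) (hw : 5 + k ≤ w)
    (hns : ¬ ∃ W ⊆ M.E, W.ncard ≤ w ∧ W.encard = M.eRk W + k)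
    {X : Set α} (hX : X ⊆ M.E) {r : ℕ} (hr5 : r ≤ 5) (hXr : M.eRk X ≤ r) : X.ncard + 1 ≤ r + k := by
  classical
  by_contra hbig
  push Not at hbig
  have hXfin : X.Finite := M.ground_finite.subset hX
  have hk' : M.eRk X + k ≤ X.encard := by
    calc M.eRk X + k ≤ (r : ℕ∞) + k := by gcongr
      _ = ((r + k : ℕ) : ℕ∞) := by push_cast; rfl
      _ ≤ (X.ncard : ℕ∞) := by exact_mod_cast (show r + k ≤ X.ncard by omega)
      _ = X.encard := hXfin.cast_ncard_eq
  obtain ⟨W', hW'X, hW'⟩ := exists_subset_encard_eq_eRk_add M hX k hk'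
  have hW'fin : W'.Finite := hXfin.subset hW'X
  have h1 : W'.encard ≤ ((r + k : ℕ) : ℕ∞) := by
    rw [hW']
    calc M.eRk W' + k ≤ M.eRk X + k := by gcongr; exact M.eRk_mono hW'X
      _ ≤ (r : ℕ∞) + k := by gcongr
      _ = ((r + k : ℕ) : ℕ∞) := by push_cast; rfl
  rw [← hW'fin.cast_ncard_eq] at h1
  have h2 : W'.ncard ≤ r + k := by exact_mod_cast h1
  exact hns ⟨W', hW'X.trans hX, by omega, hW'⟩

end S2

namespace ThmN

open Set

variable {α : Type}

/-- **The top count at level `5` with the `5`-element term a parameter and the flat sizes parameters**: on the `e`-free core of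
rank `p` and corank `d ≥ 6` with every rank-`≤ 5` set of `≤ f` points and every rank-`≤ 4` set of `≤ f'` points
(`f' − 5 ≤ min (f − 6) (ν₁ − 2) ≤ min f (5 + d) − 6`, `ν₁ = (d + 6)/2 + 1`),
`#U(p, 5) ≤ V + σ_m(f)·(s3b·C(n − 3, 3) + s4b·C(n − 4, 2) + s5b·(n − 5) + C(d + 5, 6)) + (σ_g(f) − σ_m(f))·C(min f (5 + d), 6)`
for any `V ≥ #{B ⊆ E : |B| = 5, ρ(E ∖ B) = ρ(E)}` (quart weights `1/μ(j + 1)`). -/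
theorem topCount_le_payment_flat (M : Matroid α) [M.Finite] (p d : ℕ) (hd6 : 6 ≤ d)
    (hR : M.eRank = (p : ℕ∞)) (hn : M.E.ncard = p + d)
    (hfree : ∀ e ∈ M.E, ∃ A ⊆ M.E \ {e}, e ∉ M.closure A ∧ e ∉ M.closure ((M.E \ {e}) \ A))
    (f f' : ℕ) (hflat : ∀ X ⊆ M.E, M.eRk X ≤ 5 → X.ncard ≤ f)
    (hflat' : ∀ X ⊆ M.E, M.eRk X ≤ 4 → X.ncard ≤ f')
    (hσm : f' - 5 ≤ min (f - 6) ((d + 6) / 2 + 1 - 2)) (hσg : min (f - 6) ((d + 6) / 2 + 1 - 2) ≤ min f (5 + d) - 6)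
    (s3b s4b s5b : ℕ) (hs3 : {C : Set α | M.IsCircuit C ∧ C.ncard = 3}.ncard ≤ s3b)
    (hs4 : {C : Set α | M.IsCircuit C ∧ C.ncard = 4}.ncard ≤ s4b)
    (hs5 : {C : Set α | M.IsCircuit C ∧ C.ncard = 5}.ncard ≤ s5b)
    (V : ℕ) (hV : {B : Set α | B ⊆ M.E ∧ B.ncard = 5 ∧ M.eRk (M.E \ B) = M.eRank}.ncard ≤ V) :
    (Matroid.topCount M p 5 : ℚ) ≤ (V : ℚ) +
      (∑ j ∈ Finset.range (d - 5), (Nat.choose (min (f - 6) ((d + 6) / 2 + 1 - 2)) j : ℚ) / (((j + 1) + 3 * (j + 1).choose 2 + 3 * (j + 1).choose 3 + 2 * (j + 1).choose 4 : ℕ) : ℚ)) *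
        ((s3b * (p + d - 3).choose 3 + s4b * (p + d - 4).choose 2 +
          s5b * (p + d - 5) + (d + 5).choose 6 : ℕ) : ℚ) +
      ((∑ j ∈ Finset.range (d - 5), (Nat.choose (min f (5 + d) - 6) j : ℚ) / (((j + 1) + 3 * (j + 1).choose 2 + 3 * (j + 1).choose 3 + 2 * (j + 1).choose 4 : ℕ) : ℚ)) -
        (∑ j ∈ Finset.range (d - 5), (Nat.choose (min (f - 6) ((d + 6) / 2 + 1 - 2)) j : ℚ) / (((j + 1) + 3 * (j + 1).choose 2 + 3 * (j + 1).choose 3 + 2 * (j + 1).choose 4 : ℕ) : ℚ))) *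
        ((min f (5 + d)).choose 6 : ℚ) := by
  classical
  have hL0 : ∀ e ∈ M.E, ¬ M.IsLoop e := not_isLoop_of_free M hfree
  have hs : ∀ e ∈ M.E, ∀ f ∈ M.E, e ≠ f → M.eRk {e, f} = 2 := by
    intro e he f hf hef
    have h2 : (2 : ℕ∞) ≤ M.eRk {e, f} :=
      two_le_eRk_of_two_le_ncard_of_free M hfree (pair_subset he hf) (by rw [ncard_pair hef])
    have h3 : M.eRk {e, f} ≤ 2 := by
      have := M.eRk_le_encard {e, f}
      rwa [encard_pair hef] at this
    exact le_antisymm h3 h2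
  have hcirc : ∀ C, M.IsCircuit C → 3 ≤ C.encard := three_le_encard_of_circuit M hL0 hs
  have hd : M.E.encard = M.eRank + d := by
    rw [hR, ← M.ground_finite.cast_ncard_eq, hn]
    push_cast
    ring
  have hC1 : ∀ L ⊆ M.E, M.eRk L = 2 → L.ncard ≤ 3 :=
    fun L hL hr => ncard_le_three_of_eRk_two M hs hfree hL hr
  have hC2 : ∀ P ⊆ M.E, M.eRk P ≤ 3 → P.ncard ≤ 6 :=
    fun P hP hr => ncard_le_six_of_eRk_le_three_of_free M hfree hP hr
  have hs6 : {C | M.IsCircuit C ∧ C.ncard = 6}.ncard ≤ (d + 5).choose 6 :=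
    Matroid.ncard_circuits_le_choose_of_encard M hd 5
  have hflat'' : ∀ X ⊆ M.E, M.eRk X ≤ ((5 - 1 : ℕ) : ℕ∞) → X.ncard ≤ f' := fun X hX hr =>
    hflat' X hX (by simpa using hr)
  have hU0 := S2.ncard_eRk_eq_ncard_le_le_sets_indep_quart M 5 f f' ((d + 6) / 2 + 1) 6 d (by norm_num)
    hcirc hC1 hC2 hflat hflat'' (hinter_five M hfree) hd (by omega) hσm hσg
  have hU1 := S2.topCount_le_ncard_compl_spanning (M := M) hR hd 5
  have hsplit := S2.ncard_spanning_level_add_le_split (M := M) 5 d (by omega)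
  simp only [show (5 : ℕ) + 1 = 6 from rfl] at hU0
  rw [hn, sum_Icc_three_six_q, show d - 6 + 1 = d - 5 by omega] at hU0
  simp only [show (6 : ℕ) - 3 = 3 from rfl, show (6 : ℕ) - 4 = 2 from rfl,
    show (6 : ℕ) - 5 = 1 from rfl, show (6 : ℕ) - 6 = 0 from rfl, Nat.choose_one_right,
    Nat.choose_zero_right] at hU0
  set σm : ℚ := ∑ j ∈ Finset.range (d - 5), (Nat.choose (min (f - 6) ((d + 6) / 2 + 1 - 2)) j : ℚ) / (((j + 1) + 3 * (j + 1).choose 2 + 3 * (j + 1).choose 3 + 2 * (j + 1).choose 4 : ℕ) : ℚ) with hσmdef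
  have hsm : {C | M.IsCircuit C ∧ C.ncard = 3}.ncard * (p + d - 3).choose 3 +
      {C | M.IsCircuit C ∧ C.ncard = 4}.ncard * (p + d - 4).choose 2 +
      {C | M.IsCircuit C ∧ C.ncard = 5}.ncard * (p + d - 5) + {C | M.IsCircuit C ∧ C.ncard = 6}.ncard * 1 ≤
      s3b * (p + d - 3).choose 3 + s4b * (p + d - 4).choose 2 + s5b * (p + d - 5) + (d + 5).choose 6 := by
    have := hs6
    gcongr
    omega
  have hsmq : (({C | M.IsCircuit C ∧ C.ncard = 3}.ncard : ℚ) * ((p + d - 3).choose 3 : ℚ) +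
      ({C | M.IsCircuit C ∧ C.ncard = 4}.ncard : ℚ) * ((p + d - 4).choose 2 : ℚ) +
      ({C | M.IsCircuit C ∧ C.ncard = 5}.ncard : ℚ) * ((p + d - 5 : ℕ) : ℚ) +
      ({C | M.IsCircuit C ∧ C.ncard = 6}.ncard : ℚ) * ((1 : ℕ) : ℚ)) ≤
      ((s3b * (p + d - 3).choose 3 + s4b * (p + d - 4).choose 2 + s5b * (p + d - 5) + (d + 5).choose 6 : ℕ) : ℚ) := by
    exact_mod_cast hsm
  have hσm0 : (0 : ℚ) ≤ σm := Finset.sum_nonneg (fun j _ => by positivity)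
  have hU1q : (Matroid.topCount M p 5 : ℚ) ≤
      ({B : Set α | B ⊆ M.E ∧ M.eRk B = 5 ∧ B.ncard ≤ d ∧ M.eRk (M.E \ B) = M.eRank}.ncard : ℚ) := by
    exact_mod_cast hU1
  have hsplitq : ({B : Set α | B ⊆ M.E ∧ M.eRk B = 5 ∧ B.ncard ≤ d ∧ M.eRk (M.E \ B) = M.eRank}.ncard : ℚ) +
      ({B : Set α | B ⊆ M.E ∧ B.ncard = 5 ∧ M.eRk B = 5}.ncard : ℚ) ≤
      ({B : Set α | B ⊆ M.E ∧ B.ncard = 5 ∧ M.eRk (M.E \ B) = M.eRank}.ncard : ℚ) +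
      ({B : Set α | B ⊆ M.E ∧ M.eRk B = 5 ∧ B.ncard ≤ d}.ncard : ℚ) := by
    exact_mod_cast hsplit
  have hVq : ({B : Set α | B ⊆ M.E ∧ B.ncard = 5 ∧ M.eRk (M.E \ B) = M.eRank}.ncard : ℚ) ≤ (V : ℚ) := by
    exact_mod_cast hV
  have e1 := mul_le_mul_of_nonneg_left hsmq hσm0
  push_cast at e1 hU0 ⊢
  linarith [hU1q, hsplitq, hVq, hU0, e1]

/-- **The top count at level `5` with the flat sizes parameters and the independent `5`-sets crude**: as
`topCount_le_payment_flat` with `V = C(n, 5) + C(s3b, 2)` (for the spread case, where no `W` pays). -/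
theorem topCount_le_flat (M : Matroid α) [M.Finite] (p d : ℕ) (hd6 : 6 ≤ d)
    (hR : M.eRank = (p : ℕ∞)) (hn : M.E.ncard = p + d)
    (hfree : ∀ e ∈ M.E, ∃ A ⊆ M.E \ {e}, e ∉ M.closure A ∧ e ∉ M.closure ((M.E \ {e}) \ A))
    (f f' : ℕ) (hflat : ∀ X ⊆ M.E, M.eRk X ≤ 5 → X.ncard ≤ f)
    (hflat' : ∀ X ⊆ M.E, M.eRk X ≤ 4 → X.ncard ≤ f')
    (hσm : f' - 5 ≤ min (f - 6) ((d + 6) / 2 + 1 - 2)) (hσg : min (f - 6) ((d + 6) / 2 + 1 - 2) ≤ min f (5 + d) - 6)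
    (s3b s4b s5b : ℕ) (hs3 : {C : Set α | M.IsCircuit C ∧ C.ncard = 3}.ncard ≤ s3b)
    (hs4 : {C : Set α | M.IsCircuit C ∧ C.ncard = 4}.ncard ≤ s4b)
    (hs5 : {C : Set α | M.IsCircuit C ∧ C.ncard = 5}.ncard ≤ s5b) :
    (Matroid.topCount M p 5 : ℚ) ≤ (((p + d).choose 5 + s3b.choose 2 : ℕ) : ℚ) +
      (∑ j ∈ Finset.range (d - 5), (Nat.choose (min (f - 6) ((d + 6) / 2 + 1 - 2)) j : ℚ) / (((j + 1) + 3 * (j + 1).choose 2 + 3 * (j + 1).choose 3 + 2 * (j + 1).choose 4 : ℕ) : ℚ)) *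
        ((s3b * (p + d - 3).choose 3 + s4b * (p + d - 4).choose 2 +
          s5b * (p + d - 5) + (d + 5).choose 6 : ℕ) : ℚ) +
      ((∑ j ∈ Finset.range (d - 5), (Nat.choose (min f (5 + d) - 6) j : ℚ) / (((j + 1) + 3 * (j + 1).choose 2 + 3 * (j + 1).choose 3 + 2 * (j + 1).choose 4 : ℕ) : ℚ)) -
        (∑ j ∈ Finset.range (d - 5), (Nat.choose (min (f - 6) ((d + 6) / 2 + 1 - 2)) j : ℚ) / (((j + 1) + 3 * (j + 1).choose 2 + 3 * (j + 1).choose 3 + 2 * (j + 1).choose 4 : ℕ) : ℚ))) *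
        ((min f (5 + d)).choose 6 : ℚ) := by
  classical
  have hL0 : ∀ e ∈ M.E, ¬ M.IsLoop e := not_isLoop_of_free M hfree
  have hs : ∀ e ∈ M.E, ∀ f ∈ M.E, e ≠ f → M.eRk {e, f} = 2 := by
    intro e he f hf hef
    have h2 : (2 : ℕ∞) ≤ M.eRk {e, f} :=
      two_le_eRk_of_two_le_ncard_of_free M hfree (pair_subset he hf) (by rw [ncard_pair hef])
    have h3 : M.eRk {e, f} ≤ 2 := by
      have := M.eRk_le_encard {e, f}
      rwa [encard_pair hef] at this
    exact le_antisymm h3 h2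
  have hcirc : ∀ C, M.IsCircuit C → 3 ≤ C.encard := three_le_encard_of_circuit M hL0 hs
  have hd : M.E.encard = M.eRank + d := by
    rw [hR, ← M.ground_finite.cast_ncard_eq, hn]
    push_cast
    ring
  have hC1 : ∀ L ⊆ M.E, M.eRk L = 2 → L.ncard ≤ 3 :=
    fun L hL hr => ncard_le_three_of_eRk_two M hs hfree hL hr
  have hC2 : ∀ P ⊆ M.E, M.eRk P ≤ 3 → P.ncard ≤ 6 :=
    fun P hP hr => ncard_le_six_of_eRk_le_three_of_free M hfree hP hr
  have hs6 : {C | M.IsCircuit C ∧ C.ncard = 6}.ncard ≤ (d + 5).choose 6 :=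
    Matroid.ncard_circuits_le_choose_of_encard M hd 5
  have hflat'' : ∀ X ⊆ M.E, M.eRk X ≤ ((5 - 1 : ℕ) : ℕ∞) → X.ncard ≤ f' := fun X hX hr =>
    hflat' X hX (by simpa using hr)
  have hU0 := S2.ncard_eRk_eq_ncard_le_le_sets_indep_quart M 5 f f' ((d + 6) / 2 + 1) 6 d (by norm_num)
    hcirc hC1 hC2 hflat hflat'' (hinter_five M hfree) hd (by omega) hσm hσg
  have hU1 := Matroid.topCount_le_ncard_compl (M := M) hR hd 5
  simp only [show (5 : ℕ) + 1 = 6 from rfl] at hU0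
  rw [hn, sum_Icc_three_six_q, show d - 6 + 1 = d - 5 by omega] at hU0
  simp only [show (6 : ℕ) - 3 = 3 from rfl, show (6 : ℕ) - 4 = 2 from rfl,
    show (6 : ℕ) - 5 = 1 from rfl, show (6 : ℕ) - 6 = 0 from rfl, Nat.choose_one_right,
    Nat.choose_zero_right] at hU0
  set σm : ℚ := ∑ j ∈ Finset.range (d - 5), (Nat.choose (min (f - 6) ((d + 6) / 2 + 1 - 2)) j : ℚ) / (((j + 1) + 3 * (j + 1).choose 2 + 3 * (j + 1).choose 3 + 2 * (j + 1).choose 4 : ℕ) : ℚ) with hσmdef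
  have hsm : {C | M.IsCircuit C ∧ C.ncard = 3}.ncard * (p + d - 3).choose 3 +
      {C | M.IsCircuit C ∧ C.ncard = 4}.ncard * (p + d - 4).choose 2 +
      {C | M.IsCircuit C ∧ C.ncard = 5}.ncard * (p + d - 5) + {C | M.IsCircuit C ∧ C.ncard = 6}.ncard * 1 ≤
      s3b * (p + d - 3).choose 3 + s4b * (p + d - 4).choose 2 + s5b * (p + d - 5) + (d + 5).choose 6 := by
    have := hs6
    gcongr
    omega
  have hsmq : (({C | M.IsCircuit C ∧ C.ncard = 3}.ncard : ℚ) * ((p + d - 3).choose 3 : ℚ) +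
      ({C | M.IsCircuit C ∧ C.ncard = 4}.ncard : ℚ) * ((p + d - 4).choose 2 : ℚ) +
      ({C | M.IsCircuit C ∧ C.ncard = 5}.ncard : ℚ) * ((p + d - 5 : ℕ) : ℚ) +
      ({C | M.IsCircuit C ∧ C.ncard = 6}.ncard : ℚ) * ((1 : ℕ) : ℚ)) ≤
      ((s3b * (p + d - 3).choose 3 + s4b * (p + d - 4).choose 2 + s5b * (p + d - 5) + (d + 5).choose 6 : ℕ) : ℚ) := by
    exact_mod_cast hsm
  have hσm0 : (0 : ℚ) ≤ σm := Finset.sum_nonneg (fun j _ => by positivity)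
  -- the independent `5`-sets, crude: `≤ C(n, 5) + C(s3b, 2)`
  have hI5 := S2.ncard_indep_five_add_le (M := M) hC1
  rw [hn] at hI5
  have hch : ({C : Set α | M.IsCircuit C ∧ C.ncard = 3}.ncard).choose 2 ≤ s3b.choose 2 :=
    Nat.choose_le_choose 2 hs3
  have hI5' : {B : Set α | B ⊆ M.E ∧ B.ncard = 5 ∧ M.eRk B = 5}.ncard ≤ (p + d).choose 5 + s3b.choose 2 := by
    omega
  have hU1q : (Matroid.topCount M p 5 : ℚ) ≤
      ({B : Set α | B ⊆ M.E ∧ M.eRk B = 5 ∧ B.ncard ≤ d}.ncard : ℚ) := by exact_mod_cast hU1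
  have hI5q : ({B : Set α | B ⊆ M.E ∧ B.ncard = 5 ∧ M.eRk B = 5}.ncard : ℚ) ≤
      (((p + d).choose 5 + s3b.choose 2 : ℕ) : ℚ) := by exact_mod_cast hI5'
  have e1 := mul_le_mul_of_nonneg_left hsmq hσm0
  push_cast at e1 hU0 hI5q ⊢
  linarith [hU1q, hI5q, hU0, e1]

end ThmN

end PercRepro
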